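import Literature.AnabelianGeometry.SemiGraphs.UniversalCoveringOver
import Literature.AnabelianGeometry.SemiGraphs.OrbitGraphOrbits
import HarnessLib

/-!
# `𝒢_{∞,S}` has a single connected component ([SemiAnbd] §3 p. 38)

Proof-only file.  For any object `S` of `B^cov(𝒢)` and base component `c` of `𝔾_S`, the covering
`𝒢_{∞,S} = univCoverOver S c` (`UniversalCoveringOver.lean`) is *connected as a covering*: any two
of its points lie in the same connected component (`CovObj.SameComponent`, Def. 3.5 (ii) p. 37).
Indeed a point `(V, x, p)` is joined to the points over the base by following a zigzag representing
the path class `p` (gluings along branches and their inverses) and the `Π_v`-actions on the orbits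
— the same transport as in the rigidity theorem `univCoverOver_hom_ext`
(`UniversalCoveringOverRigid.lean`).  This is the "`𝒢_{∞,i}` connected" half of [SemiAnbd] p. 38
("`𝒢_{∞,i} → 𝒢` … Galois").
-/

namespace Literature.AnabelianGeometry.SemiGraphs

namespace ProfiniteSemiGraph

open CategoryTheory

universe u

variable {𝒢 : ProfiniteSemiGraph.{u}} (S : CovObj 𝒢) (c : S.orbitGraph.CatCarrier)
  (h𝒢 : 𝒢.IsCountable) (P : (S.univCoverOver c h𝒢).Point)

/-- `P` is in the component of every point of `𝒢_{∞,S}` with path component `p : c ⟶ a`.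
[cite: MochizukiSemiAnbd2006, Prop 3.6 p.38] -/
def CovObj.ConnAt : (a : Quiver.FreeGroupoid S.orbitGraph.CatCarrier) →
    (S.orbitGraph.basept c ⟶ a) → Prop
  | ⟨Sum.inl V⟩, p => ∀ (x : (S.SV (CovObj.OVertex.base S V)).obj.V)
      (hx : Quot.mk S.VRel ⟨_, x⟩ = V),
      (S.univCoverOver c h𝒢).SameComponent P
        (Sum.inl ⟨_, (⟨⟨V, rfl⟩, ⟨⟨x, hx⟩, p⟩⟩ : S.FibV c (CovObj.OVertex.base S V))⟩)
  | ⟨Sum.inr E⟩, q => ∀ (y : (S.SE (CovObj.OEdge.base S E)).obj.V)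
      (hy : Quot.mk S.ERel ⟨_, y⟩ = E),
      (S.univCoverOver c h𝒢).SameComponent P
        (Sum.inr ⟨_, (⟨⟨E, rfl⟩, ⟨⟨y, hy⟩, q⟩⟩ : S.FibE c (CovObj.OEdge.base S E))⟩)

/-- One point of a vertex fibre suffices: the other points of the orbit are reached by the action.
[cite: MochizukiSemiAnbd2006, Prop 3.6 p.38] -/
theorem CovObj.connAt_inl_of_one (V : S.OVertex)
    (p : S.orbitGraph.basept c ⟶ S.orbitGraph.basept (Sum.inl V))
    (x₀ : (S.SV (CovObj.OVertex.base S V)).obj.V) (hx₀ : Quot.mk S.VRel ⟨_, x₀⟩ = V)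
    (h₀ : (S.univCoverOver c h𝒢).SameComponent P
      (Sum.inl ⟨_, (⟨⟨V, rfl⟩, ⟨⟨x₀, hx₀⟩, p⟩⟩ : S.FibV c (CovObj.OVertex.base S V))⟩)) :
    CovObj.ConnAt S c h𝒢 P (S.orbitGraph.basept (Sum.inl V)) p := by
  intro x hx
  obtain ⟨g, hg⟩ := S.exists_ρ_of_mk_eq_mk (hx₀.trans hx.symm)
  have ht : (⟨⟨V, rfl⟩, ⟨⟨x, hx⟩, p⟩⟩ : S.FibV c (CovObj.OVertex.base S V)) =
      S.fibVAct c _ g ⟨⟨V, rfl⟩, ⟨⟨x₀, hx₀⟩, p⟩⟩ :=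
    CovObj.FibV.ext S c rfl hg.symm HEq.rfl
  rw [ht]
  exact h₀.trans _ _ _ (Relation.EqvGen.rel _ _ (CovObj.Adj.vertex _ g _))

/-- One point of an edge fibre suffices. [cite: MochizukiSemiAnbd2006, Prop 3.6 p.38] -/
theorem CovObj.connAt_inr_of_one (E : S.OEdge)
    (q : S.orbitGraph.basept c ⟶ S.orbitGraph.basept (Sum.inr E))
    (y₀ : (S.SE (CovObj.OEdge.base S E)).obj.V) (hy₀ : Quot.mk S.ERel ⟨_, y₀⟩ = E)
    (h₀ : (S.univCoverOver c h𝒢).SameComponent P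
      (Sum.inr ⟨_, (⟨⟨E, rfl⟩, ⟨⟨y₀, hy₀⟩, q⟩⟩ : S.FibE c (CovObj.OEdge.base S E))⟩)) :
    CovObj.ConnAt S c h𝒢 P (S.orbitGraph.basept (Sum.inr E)) q := by
  intro y hy
  obtain ⟨g, hg⟩ := S.exists_ρE_of_mk_eq_mk (hy₀.trans hy.symm)
  have ht : (⟨⟨E, rfl⟩, ⟨⟨y, hy⟩, q⟩⟩ : S.FibE c (CovObj.OEdge.base S E)) =
      S.fibEAct c _ g ⟨⟨E, rfl⟩, ⟨⟨y₀, hy₀⟩, q⟩⟩ :=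
    CovObj.FibE.ext S c rfl hg.symm HEq.rfl
  rw [ht]
  exact h₀.trans _ _ _ (Relation.EqvGen.rel _ _ (CovObj.Adj.edge _ g _))

/-- Forward step along a branch `b : E → V`: the glued point `(V, glue y, q ≫ b̃)` is adjacent to
`(E, y, q)`. [cite: MochizukiSemiAnbd2006, Prop 3.6 p.38] -/
theorem CovObj.connAt_forward (b : 𝒢.graph.Branch) (E : S.OEdge)
    (hE : CovObj.OEdge.base S E = 𝒢.graph.edgeOf b) (V : S.OVertex)
    (hv : S.orbitGraph.abuts ⟨(b, E), hE⟩ = some V)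
    (q : S.orbitGraph.basept c ⟶ S.orbitGraph.basept (Sum.inr E))
    (hq : CovObj.ConnAt S c h𝒢 P (S.orbitGraph.basept (Sum.inr E)) q) :
    CovObj.ConnAt S c h𝒢 P (S.orbitGraph.basept (Sum.inl V))
      (q ≫ S.orbitGraph.brArrow ⟨(b, E), hE⟩ E V rfl hv) := by
  have h : 𝒢.graph.abuts b = some (CovObj.OVertex.base S V) :=
    S.orbitGraphProj.abuts_branchMap ⟨(b, E), hE⟩ V hv
  revert hE hv q
  induction E using Quot.ind with
  | mk pr =>
  obtain ⟨e', y'⟩ := pr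
  intro hE
  cases hE
  intro hv q hq
  have h1 := hq y' rfl
  -- the glued point is adjacent to `(E, y', q)`
  have hadj := CovObj.Adj.glue (S := S.univCoverOver c h𝒢) b _ h
    (⟨⟨Quot.mk _ ⟨_, y'⟩, rfl⟩, ⟨⟨y', rfl⟩, q⟩⟩ : S.FibE c _)
  have hVV : V = Quot.mk _ ⟨_, (S.glue b _ h).hom.hom.hom y'⟩ :=
    Option.some.inj (hv.symm.trans (S.orbitGraph_abuts_mk b _ h ⟨Quot.mk _ ⟨_, y'⟩, rfl⟩ y' rfl))
  refine S.connAt_inl_of_one c h𝒢 P V _ ((S.glue b _ h).hom.hom.hom y') hVV.symm ?_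
  have hpt : (⟨⟨V, rfl⟩, ⟨⟨(S.glue b _ h).hom.hom.hom y', hVV.symm⟩,
      q ≫ S.orbitGraph.brArrow ⟨(b, Quot.mk _ ⟨_, y'⟩), rfl⟩ _ V rfl hv⟩⟩ :
        S.FibV c (CovObj.OVertex.base S V)) =
      ((S.univCoverOver c h𝒢).glue b _ h).hom.hom.hom
        (⟨⟨Quot.mk _ ⟨_, y'⟩, rfl⟩, ⟨⟨y', rfl⟩, q⟩⟩ : S.FibE c _) := by
    change _ = S.glueOverFun c b _ h _
    refine CovObj.FibV.ext S c (Subtype.ext hVV) rfl ?_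
    have aux : ∀ (V₁ V₂ : S.OVertex) (e : V₁ = V₂)
        (h₁ : S.orbitGraph.abuts ⟨(b, Quot.mk _ ⟨_, y'⟩), rfl⟩ = some V₁)
        (h₂ : S.orbitGraph.abuts ⟨(b, Quot.mk _ ⟨_, y'⟩), rfl⟩ = some V₂),
        HEq (q ≫ S.orbitGraph.brArrow ⟨(b, Quot.mk _ ⟨_, y'⟩), rfl⟩ _ V₁ rfl h₁)
          (q ≫ S.orbitGraph.brArrow ⟨(b, Quot.mk _ ⟨_, y'⟩), rfl⟩ _ V₂ rfl h₂) := by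
      intro V₁ V₂ e h₁ h₂; subst e; rfl
    exact aux _ _ hVV _ _
  rw [hpt]
  exact h1.trans _ _ _ (Relation.EqvGen.rel _ _ hadj)

/-- Backward step along a branch `b : E → V`: the point `(E, y, r ≫ b̃⁻¹)` glues to `(V, glue y, r)`.
[cite: MochizukiSemiAnbd2006, Prop 3.6 p.38] -/
theorem CovObj.connAt_backward (b : 𝒢.graph.Branch) (E : S.OEdge)
    (hE : CovObj.OEdge.base S E = 𝒢.graph.edgeOf b) (V : S.OVertex)
    (hv : S.orbitGraph.abuts ⟨(b, E), hE⟩ = some V)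
    (ρ : S.orbitGraph.basept (Sum.inl V) ⟶ S.orbitGraph.basept (Sum.inr E))
    (hρ : ρ ≫ S.orbitGraph.brArrow ⟨(b, E), hE⟩ E V rfl hv = 𝟙 _)
    (r : S.orbitGraph.basept c ⟶ S.orbitGraph.basept (Sum.inl V))
    (hr : CovObj.ConnAt S c h𝒢 P (S.orbitGraph.basept (Sum.inl V)) r) :
    CovObj.ConnAt S c h𝒢 P (S.orbitGraph.basept (Sum.inr E)) (r ≫ ρ) := by
  have h : 𝒢.graph.abuts b = some (CovObj.OVertex.base S V) :=
    S.orbitGraphProj.abuts_branchMap ⟨(b, E), hE⟩ V hv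
  revert hE hv ρ
  induction E using Quot.ind with
  | mk pr =>
  obtain ⟨e', y'⟩ := pr
  intro hE
  cases hE
  intro hv ρ hρ y hy
  have hV2 : V = Quot.mk _ ⟨_, (S.glue b _ h).hom.hom.hom y⟩ :=
    Option.some.inj (hv.symm.trans (S.orbitGraph_abuts_mk b _ h ⟨Quot.mk _ ⟨_, y'⟩, rfl⟩ y hy))
  have hpt : (⟨⟨V, rfl⟩, ⟨⟨(S.glue b _ h).hom.hom.hom y, hV2.symm⟩, r⟩⟩ :
        S.FibV c (CovObj.OVertex.base S V)) =
      ((S.univCoverOver c h𝒢).glue b _ h).hom.hom.hom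
        (⟨⟨Quot.mk _ ⟨_, y'⟩, rfl⟩, ⟨⟨y, hy⟩, r ≫ ρ⟩⟩ : S.FibE c _) := by
    change _ = S.glueOverFun c b _ h _
    refine CovObj.FibV.ext S c (Subtype.ext hV2) rfl ?_
    have aux : ∀ (V₂ : S.OVertex) (e : V = V₂)
        (h₂ : S.orbitGraph.abuts ⟨(b, Quot.mk _ ⟨_, y'⟩), rfl⟩ = some V₂),
        HEq r ((r ≫ ρ) ≫ S.orbitGraph.brArrow ⟨(b, Quot.mk _ ⟨_, y'⟩), rfl⟩ _ V₂ rfl h₂) := by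
      intro V₂ e h₂
      subst e
      apply heq_of_eq
      rw [Category.assoc]
      exact ((congrArg (r ≫ ·) hρ).trans (Category.comp_id r)).symm
    exact aux _ hV2 _
  have h1 := hr ((S.glue b _ h).hom.hom.hom y) hV2.symm
  rw [hpt] at h1
  have hadj := CovObj.Adj.glue (S := S.univCoverOver c h𝒢) b _ h
    (⟨⟨Quot.mk _ ⟨_, y'⟩, rfl⟩, ⟨⟨y, hy⟩, r ≫ ρ⟩⟩ : S.FibE c _)
  exact h1.trans _ _ _ (Relation.EqvGen.symm _ _ (Relation.EqvGen.rel _ _ hadj))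

/-- The class of the reversed arrow of a branch followed by the class of the arrow is the identity.
[cite: MochizukiSemiAnbd2006, Def. 2.11 p.32] -/
private theorem map_reverse_comp_brArrow' (bt : S.orbitGraph.Branch) (E : S.orbitGraph.Edge)
    (V : S.orbitGraph.Vertex) (he : S.orbitGraph.edgeOf bt = E) (hv : S.orbitGraph.abuts bt = some V) :
    ((CategoryTheory.Quotient.functor
        (@Quiver.FreeGroupoid.redStep S.orbitGraph.CatCarrier S.orbitGraph.catQuiver)).map
      (@Quiver.Hom.toPath (Quiver.Symmetrify S.orbitGraph.CatCarrier)
        (@Quiver.symmetrifyQuiver _ S.orbitGraph.catQuiver) (Sum.inl V) (Sum.inr E)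
        (Sum.inr (⟨bt, he, hv⟩ : SemiGraph.CatArrow (Sum.inr E) (Sum.inl V)))) :
      S.orbitGraph.basept (Sum.inl V) ⟶ S.orbitGraph.basept (Sum.inr E)) ≫
      S.orbitGraph.brArrow bt E V he hv = 𝟙 _ := by
  have h := CategoryTheory.Quotient.sound
    (@Quiver.FreeGroupoid.redStep S.orbitGraph.CatCarrier S.orbitGraph.catQuiver)
    (@Quiver.FreeGroupoid.redStep.step S.orbitGraph.CatCarrier S.orbitGraph.catQuiver
      (Sum.inl V) (Sum.inr E) (Sum.inr (⟨bt, he, hv⟩ : SemiGraph.CatArrow (Sum.inr E) (Sum.inl V))))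
  rw [CategoryTheory.Functor.map_id, CategoryTheory.Functor.map_comp] at h
  exact h.symm

/-- One zigzag step. [cite: MochizukiSemiAnbd2006, Prop 3.6 p.38] -/
private theorem connAt_step (y z : S.orbitGraph.CatCarrier)
    (g : @Quiver.Hom (Quiver.Symmetrify S.orbitGraph.CatCarrier)
      (@Quiver.symmetrifyQuiver _ S.orbitGraph.catQuiver) y z)
    (r : S.orbitGraph.basept c ⟶ S.orbitGraph.basept y)
    (hr : CovObj.ConnAt S c h𝒢 P (S.orbitGraph.basept y) r) :
    CovObj.ConnAt S c h𝒢 P (S.orbitGraph.basept z) (r ≫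
      (CategoryTheory.Quotient.functor
        (@Quiver.FreeGroupoid.redStep S.orbitGraph.CatCarrier S.orbitGraph.catQuiver)).map
        (@Quiver.Hom.toPath (Quiver.Symmetrify S.orbitGraph.CatCarrier)
          (@Quiver.symmetrifyQuiver _ S.orbitGraph.catQuiver) y z g)) := by
  revert g r
  refine Sum.rec (fun V => ?_) (fun E => ?_) y <;> refine Sum.rec (fun V' => ?_) (fun E' => ?_) z
    <;> intro g r hr <;> rcases g with g | g
  · exact g.elim
  · exact g.elim
  · exact g.elim
  · obtain ⟨⟨⟨b, E₀⟩, hE₀⟩, he, hv⟩ := g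
    change E₀ = E' at he
    subst he
    exact S.connAt_backward c h𝒢 P b E₀ hE₀ V hv _
      (map_reverse_comp_brArrow' S ⟨(b, E₀), hE₀⟩ E₀ V rfl hv) r hr
  · obtain ⟨⟨⟨b, E₀⟩, hE₀⟩, he, hv⟩ := g
    change E₀ = E at he
    subst he
    exact S.connAt_forward c h𝒢 P b E₀ hE₀ V' hv r hr
  · exact g.elim
  · exact g.elim
  · exact g.elim

/-- Transport of `ConnAt` along any morphism of the fundamental groupoid of `𝔾_S`.
[cite: MochizukiSemiAnbd2006, Prop 3.6 p.38] -/
theorem CovObj.connAt_transport {a a' : Quiver.FreeGroupoid S.orbitGraph.CatCarrier}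
    (f : a ⟶ a') (p : S.orbitGraph.basept c ⟶ a) (hp : CovObj.ConnAt S c h𝒢 P a p) :
    CovObj.ConnAt S c h𝒢 P a' (p ≫ f) := by
  revert p
  refine CategoryTheory.Quotient.induction
    (r := @Quiver.FreeGroupoid.redStep S.orbitGraph.CatCarrier S.orbitGraph.catQuiver)
    (P := fun {x y} f => ∀ (p : S.orbitGraph.basept c ⟶ x), CovObj.ConnAt S c h𝒢 P x p →
      CovObj.ConnAt S c h𝒢 P y (p ≫ f)) ?_ f
  intro x' y' path
  induction path with
  | nil =>
    intro p hp
    have hid : (CategoryTheory.Quotient.functor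
        (@Quiver.FreeGroupoid.redStep S.orbitGraph.CatCarrier S.orbitGraph.catQuiver)).map
          (𝟙 ((Paths.of (Quiver.Symmetrify S.orbitGraph.CatCarrier)).obj x')) = 𝟙 _ :=
      CategoryTheory.Functor.map_id _ _
    exact hid ▸ (Category.comp_id p).symm ▸ hp
  | cons path g ih =>
    intro p hp
    rename_i y'' z
    have hcons : (CategoryTheory.Quotient.functor
        (@Quiver.FreeGroupoid.redStep S.orbitGraph.CatCarrier S.orbitGraph.catQuiver)).map
          (@Quiver.Path.cons (Quiver.Symmetrify S.orbitGraph.CatCarrier)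
            (@Quiver.symmetrifyQuiver _ S.orbitGraph.catQuiver) x' y'' z path g) =
        (CategoryTheory.Quotient.functor
          (@Quiver.FreeGroupoid.redStep S.orbitGraph.CatCarrier S.orbitGraph.catQuiver)).map path ≫
        (CategoryTheory.Quotient.functor
          (@Quiver.FreeGroupoid.redStep S.orbitGraph.CatCarrier S.orbitGraph.catQuiver)).map
          (@Quiver.Hom.toPath (Quiver.Symmetrify S.orbitGraph.CatCarrier)
            (@Quiver.symmetrifyQuiver _ S.orbitGraph.catQuiver) y'' z g) := by
      rw [← CategoryTheory.Functor.map_comp]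
      rfl
    have key : (p ≫ (CategoryTheory.Quotient.functor
          (@Quiver.FreeGroupoid.redStep S.orbitGraph.CatCarrier S.orbitGraph.catQuiver)).map path) ≫
        (CategoryTheory.Quotient.functor
          (@Quiver.FreeGroupoid.redStep S.orbitGraph.CatCarrier S.orbitGraph.catQuiver)).map
          (@Quiver.Hom.toPath (Quiver.Symmetrify S.orbitGraph.CatCarrier)
            (@Quiver.symmetrifyQuiver _ S.orbitGraph.catQuiver) y'' z g) =
        p ≫ (CategoryTheory.Quotient.functor
          (@Quiver.FreeGroupoid.redStep S.orbitGraph.CatCarrier S.orbitGraph.catQuiver)).map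
          (@Quiver.Path.cons (Quiver.Symmetrify S.orbitGraph.CatCarrier)
            (@Quiver.symmetrifyQuiver _ S.orbitGraph.catQuiver) x' y'' z path g) := by
      rw [hcons]; exact Category.assoc _ _ _
    exact key ▸ connAt_step S c h𝒢 P y'' z g _ (ih p hp)

/-- **`𝒢_{∞,S}` is connected as a covering: any two of its points lie in the same connected
component.** [cite: MochizukiSemiAnbd2006, Prop 3.6 p.38] -/
theorem CovObj.univCoverOver_sameComponent (P Q : (S.univCoverOver c h𝒢).Point) :
    (S.univCoverOver c h𝒢).SameComponent P Q := by
  -- `ConnAt P` holds at the orbit of `P` with the path component of `P`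
  have base : ∃ (a : Quiver.FreeGroupoid S.orbitGraph.CatCarrier) (p₀ : S.orbitGraph.basept c ⟶ a),
      CovObj.ConnAt S c h𝒢 P a p₀ := by
    rcases P with ⟨v, t⟩ | ⟨e, t⟩
    · cases t with | mk V₀' xp =>
      cases xp with | mk xx p₀ =>
      cases xx with | mk x₀ hx₀ =>
      cases V₀' with | mk V₀ hV₀ =>
      change CovObj.OVertex.base S V₀ = v at hV₀
      subst hV₀
      exact ⟨_, p₀, S.connAt_inl_of_one c h𝒢 _ V₀ p₀ x₀ hx₀ (Relation.EqvGen.refl _)⟩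
    · cases t with | mk E₀' yq =>
      cases yq with | mk yy q₀ =>
      cases yy with | mk y₀ hy₀ =>
      cases E₀' with | mk E₀ hE₀ =>
      change CovObj.OEdge.base S E₀ = e at hE₀
      subst hE₀
      exact ⟨_, q₀, S.connAt_inr_of_one c h𝒢 _ E₀ q₀ y₀ hy₀ (Relation.EqvGen.refl _)⟩
  obtain ⟨a, p₀, hbase⟩ := base
  rcases Q with ⟨v, t⟩ | ⟨e, t⟩
  · cases t with | mk V' xq =>
    cases xq with | mk xx' p =>
    cases xx' with | mk x hx =>
    cases V' with | mk V hV =>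
    change CovObj.OVertex.base S V = v at hV
    subst hV
    have hA := S.connAt_transport c h𝒢 P (inv p₀ ≫ p) p₀ hbase
    have e : p₀ ≫ (inv p₀ ≫ p) = p := by rw [← Category.assoc, IsIso.hom_inv_id, Category.id_comp]
    rw [e] at hA
    exact hA x hx
  · cases t with | mk E' yq =>
    cases yq with | mk yy q =>
    cases yy with | mk y hy =>
    cases E' with | mk E hE =>
    change CovObj.OEdge.base S E = e at hE
    subst hE
    have hA := S.connAt_transport c h𝒢 P (inv p₀ ≫ q) p₀ hbase
    have e : p₀ ≫ (inv p₀ ≫ q) = q := by rw [← Category.assoc, IsIso.hom_inv_id, Category.id_comp]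
    rw [e] at hA
    exact hA y hy

end ProfiniteSemiGraph

end Literature.AnabelianGeometry.SemiGraphs
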